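import Summits.CriticalPhenomena.CardyFormulaZ2.Theorems.CardyIKTransportIKLinearTransportHardCrossingDecay
import Summits.CriticalPhenomena.CardyFormulaZ2.Theorems.CardyIKTransportIKLinearTransportFarRSWAllAspects

/-!
# `CardyIKTransport.IKLinearTransport` (stmt-CriticalPhenomena-5076), line `pinned-diagram-exchange` (lead c8 wave 1) — HARD
# (LONG-WAY, HORIZONTAL) CROSSINGS DECAY EXPONENTIALLY FOR EVERY COLUMN PATTERN

Support file (`--supports stmt-CriticalPhenomena-5076`; registered sub-goals `hardCrossing_decay_all`, `easyCrossing_all`).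

Generalisation of `…HardCrossingDecay.lean` (`pureIK_hardCrossing_decay`, isotropic pattern only) to EVERY column pattern `S`.
The template's only use of isotropy is the exact square probability `P_univ[LR(n × n)] = ½`; for a general pattern the square
is crossed left–right with probability at most `1 − c₁ < 1`, uniformly in the pattern and the position, because the landed
ALL-PATTERN vertical clause at aspect `1` (`FarRSWAllAspects.verticalClause_aspect 1`) gives `P_S[BT(n × n)] ≥ c₁` and the model is
exactly self-dual on boxes (`stub_duality`: `P_S[LR] + P_S[BT] = 1`).  The same ratio-mixing induction over every other `n`-square
of the long box (`nu_squares_le_gen`, the template's `nu_squares_le` with `½` replaced by a parameter `p`) then gives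
`P_S[LR((2m+1) n × n)] ≤ p ((1+η) p)^m` with `p = 1 − c₁`; choosing `η = c₁/2` makes `θ := (1 + c₁/2)(1 − c₁) < 1`:

* `hardCrossing_decay_all`: `P_S[LR((2m+1) n × n)] ≤ θ^m` for all `S`, all positions, all `m`, all `n ≥ N`;
* `easyCrossing_all` (duality): `P_S[BT((2m+1) n × n)] ≥ 1 − θ^m`.

There is NO all-pattern "tall" version here: the quarter turn is isotropic-only, and the vertical hard crossings of mixed
patterns are the open `HorizontalClause` of stmt-5911.
-/

noncomputable section

namespace Summit.CriticalPhenomena.CardyFormulaZ2.Theorems.IKLinearTransport.PinnedDiagramExchange.HardCrossingDecay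

open Summit.CriticalPhenomena.CardyFormulaZ2.Theorems.IKLinearTransport.PinnedDiagramExchange
open Summit.CriticalPhenomena.CardyFormulaZ2.Cruxes.IKMixedBoxCrossing.PairedMirrorExploration
open Summit.CriticalPhenomena.CardyFormulaZ2.Cruxes.IKMixedBoxCrossing.PairedMirrorExploration.DualityStub
  (measurableSet_lrCross)
open Summit.CriticalPhenomena.CardyFormulaZ2.Cruxes.IKMixedBoxCrossing.DefectClosureExploration
open MeasureTheory Literature.Probability.Percolation Literature.Probability.LatticeModels

/-! ## §1 The ratio-mixing induction with a parametric square bound -/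

/-- **THE RATIO-MIXING INDUCTION, PARAMETRIC**: if every `n`-square of the row `[·, · + n) × [b, b + n)` is crossed left–right with
`ν_S`-probability at most `p ≥ 0`, and `n ≥ N(η)` is a ratio-mixing scale at aspect `1`, then the `ν_S`-probability that the
`m + 1` odd squares `[a + 2jn, a + 2jn + n) × [b, b + n)`, `j ≤ m`, are all crossed is at most `p · ((1+η) p)^m` — the first `m`
squares' crossings are determined at sup-distance `≥ n` from the last square (`squares_mem_determinedOn_far`). [folklore] -/
theorem nu_squares_le_gen {η p : ℝ} (hη : 0 < η) (hp0 : 0 ≤ p) {N : ℕ}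
    (hN : ∀ (S : Set ℤ) (n : ℕ), N ≤ n → ∀ (a b : ℤ) (w h : ℕ), w ≤ 1 * n → h ≤ 1 * n →
      ∀ E L : Set Obs, MeasurableSet E → MeasurableSet L → RatioMixBound η S n a b w h E L)
    (S : Set ℤ) (a b : ℤ) {n : ℕ} (hNn : N ≤ n) (hp : ∀ a' : ℤ, pLR S a' b n n ≤ p) :
    ∀ m : ℕ, (νmix S).real (⋂ j ∈ Finset.range (m + 1), lrCross (a + 2 * j * n) b n n) ≤ p * ((1 + η) * p) ^ m := by
  have hsq : ∀ a' : ℤ, (νmix S).real (lrCross a' b n n) ≤ p := fun a' => by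
    rw [nuMix_real_lrCross]
    exact hp a'
  have hmeas : ∀ m : ℕ, MeasurableSet (⋂ j ∈ Finset.range (m + 1), lrCross (a + 2 * j * n) b n n) := fun m =>
    Finset.measurableSet_biInter _ fun j _ => measurableSet_lrCross _ _ _ _
  intro m
  induction m with
  | zero =>
      have h1 : (⋂ j ∈ Finset.range (0 + 1), lrCross (a + 2 * j * n) b n n) = lrCross a b n n := by simp
      rw [h1]
      simpa using hsq a
  | succ m ih =>
      have hsplit : (⋂ j ∈ Finset.range (m + 1 + 1), lrCross (a + 2 * j * n) b n n) =
          (⋂ j ∈ Finset.range (m + 1), lrCross (a + 2 * j * n) b n n) ∩ lrCross (a + 2 * (m + 1 : ℕ) * n) b n n := by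
        rw [Finset.range_add_one, Finset.set_biInter_insert, Set.inter_comm]
      have hmix := hN S n hNn (a + 2 * (m + 1 : ℕ) * n) b n n (by omega) (by omega) _ _
        (hmeas m) (measurableSet_lrCross _ _ _ _) (by exact_mod_cast squares_mem_determinedOn_far a b n m)
        (lrCross_mem_determinedOn _ _ _ _)
      have habs := (abs_le.1 hmix).2
      have hL := hsq (a + 2 * (m + 1 : ℕ) * n)
      have hE0 : 0 ≤ (νmix S).real (⋂ j ∈ Finset.range (m + 1), lrCross (a + 2 * j * n) b n n) := measureReal_nonneg
      have hL0 : 0 ≤ (νmix S).real (lrCross (a + 2 * (m + 1 : ℕ) * n) b n n) := measureReal_nonneg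
      rw [hsplit]
      calc (νmix S).real ((⋂ j ∈ Finset.range (m + 1), lrCross (a + 2 * j * n) b n n) ∩
              lrCross (a + 2 * (m + 1 : ℕ) * n) b n n)
          ≤ (1 + η) * ((νmix S).real (⋂ j ∈ Finset.range (m + 1), lrCross (a + 2 * j * n) b n n) *
              (νmix S).real (lrCross (a + 2 * (m + 1 : ℕ) * n) b n n)) := by linarith
        _ ≤ (1 + η) * ((p * ((1 + η) * p) ^ m) * p) := by gcongr
        _ = p * ((1 + η) * p) ^ (m + 1) := by ring

/-! ## §2 The decay theorems for every column pattern -/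

/-- **Registered sub-goal `hardCrossing_decay_all` — HARD (LONG-WAY, HORIZONTAL) CROSSINGS DECAY EXPONENTIALLY FOR EVERY COLUMN
PATTERN**: there are `θ < 1` and `N` such that for every pattern `S`, all `n ≥ N`, all `m` and all positions,
`P_S[LR((2m+1) n × n)] ≤ θ^m`.  With `c₁ > 0` the all-pattern vertical floor at aspect `1` (`FarRSWAllAspects.verticalClause_aspect 1`)
and duality (`stub_duality`), every `n`-square (`n ≥ 2`) has `P_S[LR] ≤ 1 − c₁`; ratio mixing at `η = c₁/2` (`stub_RatioMix`) and the
sub-boxes (`lrCross_long_subset_squares`) give the bound with `θ = (1 + c₁/2)(1 − c₁)`.  No positive association. [folklore] -/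
theorem hardCrossing_decay_all : ∃ θ : ℝ, θ < 1 ∧ ∃ N : ℕ, ∀ (S : Set ℤ) (n m : ℕ) (a b : ℤ), N ≤ n →
    pLR S a b ((2 * m + 1) * n) n ≤ θ ^ m := by
  obtain ⟨c, hc, hV⟩ := FarRSWAllAspects.verticalClause_aspect 1
  obtain ⟨N, hN⟩ := stub_RatioMix 1 (c / 2) (half_pos hc)
  refine ⟨(1 + c / 2) * (1 - c), by nlinarith [sq_nonneg c], max N 2, fun S n m a b hn => ?_⟩
  have h2 : 2 ≤ n := (le_max_right _ _).trans hn
  have hNn : N ≤ n := (le_max_left _ _).trans hn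
  have hp : ∀ a' : ℤ, pLR S a' b n n ≤ 1 - c := fun a' => by
    have hd := stub_duality S a' b n n h2 h2
    have hv := hV S a' b n n (by omega) (by omega) (by omega)
    linarith
  have hc1 : c ≤ 1 := by
    have hd := stub_duality S a b n n h2 h2
    have hv := hV S a b n n (by omega) (by omega) (by omega)
    have h0 : 0 ≤ pLR S a b n n := by
      rw [← nuMix_real_lrCross]
      exact measureReal_nonneg
    linarith
  have hp0 : (0 : ℝ) ≤ 1 - c := sub_nonneg.2 hc1
  have hθ0 : (0 : ℝ) ≤ (1 + c / 2) * (1 - c) := mul_nonneg (by linarith) hp0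
  haveI : IsProbabilityMeasure (νmix S) := isProbabilityMeasure_nuMix _
  rw [← nuMix_real_lrCross]
  calc (νmix S).real (lrCross a b ((2 * m + 1) * n) n)
      ≤ (νmix S).real (⋂ j ∈ Finset.range (m + 1), lrCross (a + 2 * j * n) b n n) :=
        measureReal_mono (lrCross_long_subset_squares a b (by omega) m)
    _ ≤ (1 - c) * ((1 + c / 2) * (1 - c)) ^ m := nu_squares_le_gen (half_pos hc) hp0 hN S a b hNn hp m
    _ ≤ ((1 + c / 2) * (1 - c)) ^ m := mul_le_of_le_one_left (pow_nonneg hθ0 m) (by linarith)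

/-- **Registered sub-goal `easyCrossing_all` — SHORT-WAY (VERTICAL) CROSSINGS OF LONG BOXES ARE EXPONENTIALLY CERTAIN FOR EVERY
COLUMN PATTERN**: with the `θ < 1`, `N` of `hardCrossing_decay_all` (and `N ≥ 2`), `P_S[BT((2m+1) n × n)] ≥ 1 − θ^m` for every
pattern, all `n ≥ N`, all `m` and all positions (duality `P_S[LR] + P_S[BT] = 1`, `stub_duality`). [folklore] -/
theorem easyCrossing_all : ∃ θ : ℝ, θ < 1 ∧ ∃ N : ℕ, ∀ (S : Set ℤ) (n m : ℕ) (a b : ℤ), N ≤ n →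
    1 - θ ^ m ≤ pTB S a b ((2 * m + 1) * n) n := by
  obtain ⟨θ, hθ, N, hN⟩ := hardCrossing_decay_all
  refine ⟨θ, hθ, max N 2, fun S n m a b hn => ?_⟩
  have h2 : 2 ≤ n := (le_max_right _ _).trans hn
  have hd := stub_duality S a b ((2 * m + 1) * n) n (by nlinarith) h2
  have := hN S n m a b ((le_max_left _ _).trans hn)
  linarith

end Summit.CriticalPhenomena.CardyFormulaZ2.Theorems.IKLinearTransport.PinnedDiagramExchange.HardCrossingDecay

end
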